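import Literature.NumberTheory.GaloisRepresentations.SUnitsRestrictedCohomologyDegreeOneFinite
import Literature.NumberTheory.GaloisRepresentations.RestrictedRamificationSUnitsLayerInjectivityTwo
import Literature.NumberTheory.GaloisRepresentations.IdeleSUnitsCohomologyDegreeTwo
import Literature.Algebra.Homology.DiscreteRepLayerColimitTorsionBounded
import Mathlib.Topology.Instances.AddCircle.Defs
import HarnessLib

/-!
# The `p`-torsion of `H²(U, E_S)` is FINITE, of order `≤ p^{#S₀}`, for every open `U = H/N_S ≤ G_{K,S}`, `K` totally complex
# (Neukirch–Schmidt–Wingberg (8.3.11) (ii)/(iii): `H²(G_S(F₀), E_S)(p) ↪ ⊕_{v ∈ S(F₀)} ℚ_p/ℤ_p`, in the weak form of a COUNT)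

Topic `NumberTheory/GaloisRepresentations`; namespace `Literature.NumberTheory.GaloisRepresentations.SUnits.Layers`.
THEOREMS ONLY (no definition, no named fact, no `sorry`, no instance; D-0026).  Lane «TATE-EPC-TC» of cell `bsd-eis`
(crux `GoodLatticeBDPValue`, stmt-BirchSwinnertonDyer-19032; road memo `TATE-EPC-TC-ROAD-w5g7.md`, ROUTING #5 brick (F2b)),
the second input (with (F1b) `SUnitsRestrictedCohomologyDegreeOneFinite`) of the finiteness of `H²(U, μ_p)` (brick B1a) in
the kernel proof of Tate's global Euler–Poincaré characteristic formula at totally complex `K`.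

SETTING: `K` a TOTALLY COMPLEX number field, `S` a FINITE set of finite places, `H ≤ Γ_K` open with `N_S ≤ H`,
`U := galoisGroupAbove S H = H/N_S`, `F₀ := baseField H = K̄^H` (a totally complex number field), `S₀` the finite set
of places of `F₀` above `S` (`hSF`), `E_S|_U := resRep K S H`.

THE COUNT (no homomorphism out of the colimit is built).  For a finite Galois layer `E/K`, `F₀ ≤ E ⊆ K_S`, the
`p`-torsion classes `c` of the layer `H²(Gal(E/F₀), 𝒪_{E,S}ˣ)` (door-c4's `layerRep`, read through (A2-β2)
`layerCohomologyIso`) carry the invariant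
`θ_E(c) := (inv_v (ι c))_{v ∈ S₀} ∈ (S₀ → {a ∈ ℚ/ℤ | p • a = 0})`, `ι : 𝒪_{E,S}ˣ → J_{E,S₀}` the bridge
`IdeleCohomology.sUnitsToIdeleS` and `inv_v` the tree's local invariants of `H²(Gal(E/F₀), J_E)`.  Two such classes
with `θ_E(c) = θ_E(c′)` differ by a class whose image in `H²(Gal(E/F₀), J_{E,S₀})` has all its invariants at `S₀` zero,
hence vanishes ((A3a) `IdeleCohomology.eq_zero_of_forall_mem_localInv_eq_zero`, `F₀` totally complex, `E/F₀` unramified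
outside `S₀`), hence dies in a deeper layer of `K_S` (-w4's (F2a) `exists_layerInf_two_eq_zero_of_map_sUnitsToIdeleS_eq_zero`:
capitulation), hence `c`, `c′` have the same image in `H²(U, E_S)` (§1 `inflG_eq_of_localInv_eq`).  The layers being
cofinal ((A2-β1) `exists_layerSubgroup_le`), the generic count `DiscreteRepLayerColimitTorsionBounded` gives §2:
**every finite set of `p`-torsion classes of `H²(U, E_S)` has at most `p^{#S₀}` elements**, so
`{y ∈ H²(U, E_S) | p • y = 0}` is finite with `Nat.card ≤ p^{#S₀}`
(`finsetCard_torsion_continuousCohomology_two_resRep_le`, `finite_torsion_continuousCohomology_two_resRep`,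
`natCard_torsion_continuousCohomology_two_resRep_le`).

HONEST FRAMING: an assembly of landed theorems (NSW (8.3.11) (ii)/(iii) in the weak form of a count, not the
isomorphism `H²(G_S, 𝒪_S^×)(p) ≅ ker(⊕_{v∈S} ℚ_p/ℤ_p → ℚ_p/ℤ_p)`; totally complex base only — at a real place the
archimedean invariants would enter); it proves no statement of a Summit, not Tate's formula, not the crux; 0 cells /
labels / tiers move.

## References
* J. Neukirch, A. Schmidt, K. Wingberg, *Cohomology of Number Fields*, 2nd ed. (2008), VIII §3 (8.3.11) (ii)/(iii) and
  proof, (1.5.1). [NeukirchSchmidtWingberg2008]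
* J.-P. Serre, *Cohomologie galoisienne* (1994), I §2.2 Prop. 8. [SerreGaloisCohomology1997]
* D. Harari, *Galois Cohomology and Class Field Theory* (2020), Prop. 13.1 (b), Lemma 15.39, §17.4 (17.1). [Harari2020]
* J. W. S. Cassels, A. Fröhlich (eds.), *Algebraic Number Theory* (1967), Ch. VII (J. Tate) §7.3 Prop. 7.3, Cor. 7.4 (b).
  [CasselsFrohlichANT1967]
-/

noncomputable section

open NumberField IsDedekindDomain Field Topology CategoryTheory
open Literature.NumberTheory.GaloisRepresentations.IdeleClassBar (GalLayer)
open Literature.NumberTheory.GaloisRepresentations.LocalWeilDatum (galFixing)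
open Literature.NumberTheory.IwasawaTheory.Greenberg2006 (galoisGroupAbove)
open Literature.NumberTheory.GaloisRepresentations.OpenSubgroupLayer (algOfLE isScalarTower_algOfLE baseField
  exists_layerSubgroup_le layerSubgroup_anti)
open Literature.Algebra.Homology Literature.Algebra.Homology.DiscreteRep
open Literature.Algebra.Homology.DiscreteRep.LayerColimit (stepG inflG inflG_stepG)

namespace Literature.NumberTheory.GaloisRepresentations

namespace SUnits

namespace Layers

variable {K : Type} [Field K] [NumberField K] {S : Set (HeightOneSpectrum (𝓞 K))}
  {H : Subgroup (absoluteGaloisGroup K)}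

/-! ### §0. The finite target `S₀ → (ℚ/ℤ)[p]` -/

/-- `(ℚ/ℤ)[p] = {a ∈ ℚ/ℤ | p • a = 0}` is finite (`p > 0`). [cite: CasselsFrohlichANT1967, Ch. VII §7.3 Cor. 7.4 (b)] -/
theorem finite_addCircle_torsion {p : ℕ} (hp : 0 < p) : Finite {a : AddCircle (1 : ℚ) // p • a = 0} :=
  (AddCircle.finite_torsion (1 : ℚ) hp).to_subtype

/-- `#(ℚ/ℤ)[p] ≤ p` (`p > 0`). [cite: CasselsFrohlichANT1967, Ch. VII §7.3 Cor. 7.4 (b)] -/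
theorem natCard_addCircle_torsion_le {p : ℕ} (hp : 0 < p) : Nat.card {a : AddCircle (1 : ℚ) // p • a = 0} ≤ p := by
  have hfin := AddCircle.finite_torsion (1 : ℚ) hp
  have h := AddCircle.card_torsion_le_of_isSMulRegular (1 : ℚ) p hp.ne'
    (IsSMulRegular.of_right_eq_zero_of_smul fun _ => by simp [hp.ne'])
  rw [← hfin.cast_ncard_eq, Nat.cast_le] at h
  exact (Nat.card_coe_set_eq {u : AddCircle (1 : ℚ) | p • u = 0}).trans_le h

/-- `#(S₀ → (ℚ/ℤ)[p]) ≤ p^{#S₀}`. [cite: CasselsFrohlichANT1967, Ch. VII §7.3 Cor. 7.4 (b)] -/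
theorem natCard_pi_addCircle_torsion_le {ι : Type} (S₀ : Finset ι) {p : ℕ} (hp : 0 < p) :
    Nat.card (↥S₀ → {a : AddCircle (1 : ℚ) // p • a = 0}) ≤ p ^ S₀.card := by
  classical
  haveI := finite_addCircle_torsion hp
  haveI := Fintype.ofFinite {a : AddCircle (1 : ℚ) // p • a = 0}
  rw [Nat.card_eq_fintype_card, Fintype.card_pi, Finset.prod_const, Finset.card_univ, Fintype.card_coe]
  exact Nat.pow_le_pow_left (by rw [← Nat.card_eq_fintype_card]; exact natCard_addCircle_torsion_le hp) _

/-! ### §1. Separation: equal local invariants at `S₀` ⟹ equal images in `H²(U, E_S)` -/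

/-- **Two layer classes whose images in `H²(Gal(E/F₀), J_E)` have the same invariants at `S₀` have the same image in
`H²(U, E_S)`** (`K` totally complex, `S` finite; the image is taken through (A2-β2) `layerCohomologyIso`, the bridge
`ι = IdeleCohomology.sUnitsToIdeleS : 𝒪_{E,S}ˣ → J_{E,S₀}` and `J_{E,S₀} ⊆ J_E`): their difference dies in
`H²(Gal(E/F₀), J_{E,S₀})` (joint injectivity of the local invariants over a totally complex base, `E/F₀` unramified
outside `S₀`), hence in a deeper layer of `K_S` (capitulation, (F2a)), hence in the colimit.
[cite: NeukirchSchmidtWingberg2008, VIII §3 (8.3.11) (ii)/(iii) (proof)] [cite: CasselsFrohlichANT1967, Ch. VII §7.3 Prop. 7.3] -/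
theorem inflG_eq_of_localInv_eq [IsTotallyComplex K] (hHo : IsOpen (H : Set (absoluteGaloisGroup K)))
    [NumberField ↥(baseField H)] (S₀ : Finset (HeightOneSpectrum (𝓞 ↥(baseField H))))
    (hSF : ∀ u : HeightOneSpectrum (𝓞 ↥(baseField H)), u ∈ S₀ ↔ u.under (𝓞 K) ∈ S)
    (E : GalLayer K) (hF : baseField H ≤ E.1) (hS : ramificationSubgroup K S ≤ galFixing K E.1)
    (c c' : groupCohomology (layerRep hHo E hF hS) 2)
    (h : letI := algOfLE hF
      haveI := isScalarTower_algOfLE (K := K) hF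
      haveI := E.isGalois
      haveI : NumberField ↥E.1 := E.numberField
      haveI : IsGalois ↥(baseField H) ↥E.1 := IsGalois.tower_top_of_isGalois K ↥(baseField H) ↥E.1
      ∀ v ∈ S₀, IdeleCohomology.localInv ↥E.1 v
          (groupCohomology.map (MonoidHom.id _) (IdeleCohomology.ideleSRepHom S₀) 2
            (groupCohomology.map (MonoidHom.id _) (IdeleCohomology.sUnitsToIdeleS (K := K) (E := ↥E.1) S S₀ hSF) 2
              ((layerCohomologyIso hHo E hF hS 2).hom c))) =
        IdeleCohomology.localInv ↥E.1 v
          (groupCohomology.map (MonoidHom.id _) (IdeleCohomology.ideleSRepHom S₀) 2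
            (groupCohomology.map (MonoidHom.id _) (IdeleCohomology.sUnitsToIdeleS (K := K) (E := ↥E.1) S S₀ hSF) 2
              ((layerCohomologyIso hHo E hF hS 2).hom c')))) :
    haveI := compactSpace_above K S H hHo
    inflG (OpenSubgroupLayer.layerSubgroup S hHo E hF hS) (resD K S H hHo) 2 c =
      inflG (OpenSubgroupLayer.layerSubgroup S hHo E hF hS) (resD K S H hHo) 2 c' := by
  classical
  haveI := compactSpace_above K S H hHo
  letI := algOfLE hF
  haveI := isScalarTower_algOfLE (K := K) hF
  haveI := E.finiteDimensional
  haveI := E.isGalois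
  haveI : NumberField ↥E.1 := E.numberField
  haveI : IsGalois ↥(baseField H) ↥E.1 := IsGalois.tower_top_of_isGalois K ↥(baseField H) ↥E.1
  haveI : IsTotallyComplex ↥(baseField H) := isTotallyComplex_of_algebra K ↥(baseField H)
  have hunr : ∀ v : HeightOneSpectrum (𝓞 ↥(baseField H)), v ∉ S₀ → Algebra.IsUnramifiedIn (𝓞 ↥E.1) v.asIdeal :=
    fun v hv => isUnramifiedIn_of_le_of_ramificationSubgroup_le_galFixing S hF hS v fun h' => hv ((hSF v).2 h')
  -- the difference `d = c - c'` and its image `ι d ∈ H²(Gal(E/F₀), J_{E,S₀})`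
  set d : groupCohomology (layerRep hHo E hF hS) 2 := c - c' with hd
  set x : groupCohomology (IdeleCohomology.ideleSRep ↥(baseField H) ↥E.1 S₀) 2 :=
    groupCohomology.map (MonoidHom.id _) (IdeleCohomology.sUnitsToIdeleS (K := K) (E := ↥E.1) S S₀ hSF) 2
      ((layerCohomologyIso hHo E hF hS 2).hom d) with hx
  -- all invariants of `ι d` at `S₀` vanish
  have hinv : ∀ v ∈ S₀, IdeleCohomology.localInv ↥E.1 v
      (groupCohomology.map (MonoidHom.id _) (IdeleCohomology.ideleSRepHom S₀) 2 x) = 0 := by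
    intro v hv
    rw [hx, hd, map_sub, map_sub, map_sub, map_sub, sub_eq_zero]
    exact h v hv
  -- hence `ι d = 0` (joint injectivity of the invariants, totally complex base)
  have hx0 : x = 0 := IdeleCohomology.eq_zero_of_forall_mem_localInv_eq_zero S₀ hunr x hinv
  -- hence `Inf d = 0` in a deeper layer `E'` of `K_S` (capitulation)
  obtain ⟨E', hfd', hgal', hEE', hS', hz⟩ :=
    exists_layerInf_two_eq_zero_of_map_sUnitsToIdeleS_eq_zero S hF hS S₀ hSF
      ((layerCohomologyIso hHo E hF hS 2).hom d) (by rw [← hx]; exact hx0)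
  let E'' : GalLayer K := ⟨E', hfd', hgal'⟩
  have hEE'' : E ≤ E'' := hEE'
  -- so `stepG d = 0` at the layer `E''`, and `inflG d = 0`
  have hstep : stepG (OpenSubgroupLayer.layerSubgroup S hHo E hF hS)
      (OpenSubgroupLayer.layerSubgroup S hHo E'' (hF.trans hEE'') hS') (layerSubgroup_anti S hHo hEE'' hF hS')
      (resD K S H hHo) 2 d = 0 := by
    have hsq := layerCohomologyIso_hom_stepG hHo hEE'' hF hS' 2 d
    rw [hz] at hsq
    rw [← (layerCohomologyIso hHo E'' (hF.trans hEE'') hS' 2).hom_inv_id_apply (stepG _ _ _ _ 2 d), hsq, map_zero]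
  have hinfl : inflG (OpenSubgroupLayer.layerSubgroup S hHo E hF hS) (resD K S H hHo) 2 d = 0 := by
    rw [← inflG_stepG (OpenSubgroupLayer.layerSubgroup S hHo E hF hS)
      (OpenSubgroupLayer.layerSubgroup S hHo E'' (hF.trans hEE'') hS') (layerSubgroup_anti S hHo hEE'' hF hS')
      (resD K S H hHo) 2 d, hstep, map_zero]
  rwa [hd, map_sub, sub_eq_zero] at hinfl

/-! ### §2. The layer invariant `θ_E : H²(layer)[p] → (S₀ → (ℚ/ℤ)[p])` -/

/-- **The layer invariant.**  On the `p`-torsion classes of the layer `H²(Gal(E/F₀), 𝒪_{E,S}ˣ)` there is a function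
`θ_E` to the finite type `S₀ → (ℚ/ℤ)[p]` — `θ_E(c) = (inv_v (ι c))_{v ∈ S₀}` — such that `θ_E(c) = θ_E(c′)` forces
`c`, `c′` to have the same image in `H²(U, E_S)` (`K` totally complex, `S` finite).
[cite: NeukirchSchmidtWingberg2008, VIII §3 (8.3.11) (ii)/(iii) (proof)] [cite: CasselsFrohlichANT1967, Ch. VII §7.3 Cor. 7.4 (b)] -/
theorem exists_layer_torsion_invariant [IsTotallyComplex K] (hHo : IsOpen (H : Set (absoluteGaloisGroup K)))
    [NumberField ↥(baseField H)] (S₀ : Finset (HeightOneSpectrum (𝓞 ↥(baseField H))))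
    (hSF : ∀ u : HeightOneSpectrum (𝓞 ↥(baseField H)), u ∈ S₀ ↔ u.under (𝓞 K) ∈ S)
    (E : GalLayer K) (hF : baseField H ≤ E.1) (hS : ramificationSubgroup K S ≤ galFixing K E.1) (p : ℕ) :
    haveI := compactSpace_above K S H hHo
    ∃ θ : {c : groupCohomology (layerRep hHo E hF hS) 2 // p • c = 0} → (↥S₀ → {a : AddCircle (1 : ℚ) // p • a = 0}),
      ∀ c c', θ c = θ c' →
        inflG (OpenSubgroupLayer.layerSubgroup S hHo E hF hS) (resD K S H hHo) 2 c.1 =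
          inflG (OpenSubgroupLayer.layerSubgroup S hHo E hF hS) (resD K S H hHo) 2 c'.1 := by
  haveI := compactSpace_above K S H hHo
  letI := algOfLE hF
  haveI := isScalarTower_algOfLE (K := K) hF
  haveI := E.isGalois
  haveI : NumberField ↥E.1 := E.numberField
  haveI : IsGalois ↥(baseField H) ↥E.1 := IsGalois.tower_top_of_isGalois K ↥(baseField H) ↥E.1
  -- the readout `r c v = inv_v (ι c)` (ONE elaboration of the composite; everything below flows from `hr`)
  obtain ⟨r, hr⟩ : ∃ r : groupCohomology (layerRep hHo E hF hS) 2 → HeightOneSpectrum (𝓞 ↥(baseField H)) →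
      AddCircle (1 : ℚ), ∀ c v, r c v = IdeleCohomology.localInv ↥E.1 v
        (groupCohomology.map (MonoidHom.id _) (IdeleCohomology.ideleSRepHom S₀) 2
          (groupCohomology.map (MonoidHom.id _) (IdeleCohomology.sUnitsToIdeleS (K := K) (E := ↥E.1) S S₀ hSF) 2
            ((layerCohomologyIso hHo E hF hS 2).hom c))) := ⟨_, fun _ _ => rfl⟩
  -- `p • c = 0 ⟹ p • r c v = 0` (all maps additive)
  have htors : ∀ c : groupCohomology (layerRep hHo E hF hS) 2, p • c = 0 →
      ∀ v : HeightOneSpectrum (𝓞 ↥(baseField H)), p • r c v = 0 := fun c hc v => by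
    rw [hr, ← map_nsmul, ← map_nsmul, ← map_nsmul, ← map_nsmul, hc, map_zero, map_zero, map_zero, map_zero]
  -- equal readouts at `S₀` ⟹ equal images in the colimit (§1)
  have hsep : ∀ c c' : groupCohomology (layerRep hHo E hF hS) 2, (∀ v : ↥S₀, r c v.1 = r c' v.1) →
      inflG (OpenSubgroupLayer.layerSubgroup S hHo E hF hS) (resD K S H hHo) 2 c =
        inflG (OpenSubgroupLayer.layerSubgroup S hHo E hF hS) (resD K S H hHo) 2 c' := fun c c' h => by
    refine inflG_eq_of_localInv_eq hHo S₀ hSF E hF hS c c' fun v hv => ?_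
    have h1 := h ⟨v, hv⟩
    change r c v = r c' v at h1
    rw [hr, hr] at h1
    exact h1
  refine ⟨fun c v => ⟨r c.1 v.1, htors c.1 c.2 v.1⟩, fun c c' hcc' => hsep c.1 c'.1 fun v => ?_⟩
  exact congrArg Subtype.val (congrFun hcc' v)

/-! ### §3. The `p`-torsion of `H²(U, E_S)` is finite of order `≤ p^{#S₀}` -/

/-- **Every finite set of `p`-torsion classes of `H²(U, E_S)` has at most `p^{#S₀}` elements** (`K` totally complex,
`S` finite, `U = H/N_S ≤ G_{K,S}` open, `S₀` = the places of `F₀ = K̄^H` above `S`, `p > 0`).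
[cite: NeukirchSchmidtWingberg2008, VIII §3 (8.3.11) (ii)/(iii), (1.5.1)] [cite: SerreGaloisCohomology1997, I §2.2 Prop. 8] -/
theorem finsetCard_torsion_continuousCohomology_two_resRep_le [IsTotallyComplex K]
    (hHo : IsOpen (H : Set (absoluteGaloisGroup K))) (hNH : ramificationSubgroup K S ≤ H)
    [NumberField ↥(baseField H)] (S₀ : Finset (HeightOneSpectrum (𝓞 ↥(baseField H))))
    (hSF : ∀ u : HeightOneSpectrum (𝓞 ↥(baseField H)), u ∈ S₀ ↔ u.under (𝓞 K) ∈ S) {p : ℕ} (hp : 0 < p)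
    (s : Finset (continuousCohomology 2 (resRep K S H).toTopRep)) (hs : ∀ y ∈ s, p • y = 0) :
    s.card ≤ p ^ S₀.card := by
  haveI := compactSpace_above K S H hHo
  haveI := totallyDisconnectedSpace_above (S := S) (H := H)
  haveI := finite_addCircle_torsion hp
  have hlay : ∀ W : OpenNormalSubgroup ↥(galoisGroupAbove S H),
      ∃ (V : OpenNormalSubgroup ↥(galoisGroupAbove S H)) (_ : (V : Subgroup ↥(galoisGroupAbove S H)) ≤ W)
        (θ : {c : groupCohomology ((invariantsQuotFunctor ℤ (V : Subgroup ↥(galoisGroupAbove S H))).obj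
          (resD K S H hHo)) 2 // p • c = 0} → (↥S₀ → {a : AddCircle (1 : ℚ) // p • a = 0})),
        ∀ c c', θ c = θ c' → inflG V (resD K S H hHo) 2 c.1 = inflG V (resD K S H hHo) 2 c'.1 := by
    intro W
    obtain ⟨E, hF, hS, hle⟩ := exists_layerSubgroup_le S hHo hNH W
    obtain ⟨θ, hθ⟩ := exists_layer_torsion_invariant hHo S₀ hSF E hF hS p
    exact ⟨OpenSubgroupLayer.layerSubgroup S hHo E hF hS, hle, θ, hθ⟩
  exact (LayerColimit.finsetCard_continuousCohomology_le_of_cofinal_torsion_invariant (resRep K S H).toTopRep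
    (isDiscrete_resRep K S H) 2 p hlay s hs).trans (natCard_pi_addCircle_torsion_le S₀ hp)

/-- **The `p`-torsion of `H²(U, E_S)` is finite** (`K` totally complex, `S` finite, `U = H/N_S ≤ G_{K,S}` open, `p > 0`).
[cite: NeukirchSchmidtWingberg2008, VIII §3 (8.3.11) (ii)/(iii)] [cite: SerreGaloisCohomology1997, I §2.2 Prop. 8] -/
theorem finite_torsion_continuousCohomology_two_resRep [IsTotallyComplex K]
    (hHo : IsOpen (H : Set (absoluteGaloisGroup K))) (hNH : ramificationSubgroup K S ≤ H) (hfin : S.Finite)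
    {p : ℕ} (hp : 0 < p) :
    {y : continuousCohomology 2 (resRep K S H).toTopRep | p • y = 0}.Finite := by
  classical
  haveI := numberField_baseField S hHo hNH
  obtain ⟨S₀, hSF⟩ := exists_finset_mem_iff_under_mem S hfin ↥(baseField H)
  by_contra hinf
  have hinf' : {y : continuousCohomology 2 (resRep K S H).toTopRep | p • y = 0}.Infinite := hinf
  obtain ⟨s, hs, hcard⟩ := hinf'.exists_subset_card_eq (p ^ S₀.card + 1)
  have := finsetCard_torsion_continuousCohomology_two_resRep_le hHo hNH S₀ hSF hp s fun x hx => hs hx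
  omega

/-- **`#{y ∈ H²(U, E_S) | p • y = 0} ≤ p^{#S₀}`** (`K` totally complex, `S` finite, `U = H/N_S ≤ G_{K,S}` open,
`S₀` = the places of `F₀` above `S`, `p > 0`). [cite: NeukirchSchmidtWingberg2008, VIII §3 (8.3.11) (ii)/(iii)] -/
theorem natCard_torsion_continuousCohomology_two_resRep_le [IsTotallyComplex K]
    (hHo : IsOpen (H : Set (absoluteGaloisGroup K))) (hNH : ramificationSubgroup K S ≤ H) (hfin : S.Finite)
    [NumberField ↥(baseField H)] (S₀ : Finset (HeightOneSpectrum (𝓞 ↥(baseField H))))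
    (hSF : ∀ u : HeightOneSpectrum (𝓞 ↥(baseField H)), u ∈ S₀ ↔ u.under (𝓞 K) ∈ S) {p : ℕ} (hp : 0 < p) :
    Nat.card {y : continuousCohomology 2 (resRep K S H).toTopRep // p • y = 0} ≤ p ^ S₀.card := by
  classical
  have hfin' := finite_torsion_continuousCohomology_two_resRep hHo hNH hfin hp
  haveI : Fintype {y : continuousCohomology 2 (resRep K S H).toTopRep // p • y = 0} := hfin'.fintype
  rw [Nat.card_eq_fintype_card, ← Finset.card_univ,
    ← Finset.card_map (Function.Embedding.subtype fun y : continuousCohomology 2 (resRep K S H).toTopRep => p • y = 0)]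
  refine finsetCard_torsion_continuousCohomology_two_resRep_le hHo hNH S₀ hSF hp _ fun x hx => ?_
  obtain ⟨y, -, rfl⟩ := Finset.mem_map.1 hx
  exact y.2

end Layers

end SUnits

end Literature.NumberTheory.GaloisRepresentations

end
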